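import Summits.NavierStokesRegularity.NavierStokesRegularity.Theorems.TypeILiouvilleTypeIliouvilleLInertialGaugeClassical
import Summits.NavierStokesRegularity.NavierStokesRegularity.Theses.ThreadingFlux
import Summits.NavierStokesRegularity.NavierStokesRegularity.Theses.UnthreadedDoor
import Literature.Analysis.FluidPDE.FlatSwirlGauge
import Literature.Analysis.FluidPDE.KNSSThm53OfWindow
import HarnessLib

/-!
# W1 `PoloidalLiouville` reduces BY NAME to print's class with a moving centre
# (⟨stmt-NavierStokesRegularity-1222⟩ tooling; no closure claimed)

Support file (theorems only). By the drift-regularity theorem `inertialGauge_of_smooth`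
(file `TypeILiouvilleTypeIliouvilleLInertialGaugeClassical`) every member `u` of the W1 class —
bounded ancient mild in DUALITY form, jointly `C^∞` on `(−∞,0) × ℝ³` — is the accelerated-Galilean
image `u(t, x) = V(t, x − ξ(t)) + ξ′(t)` of a bounded, jointly continuous (indeed jointly `C^∞`),
weakly divergence-free ancient solution `V` of the Oseen integral equation (print's class of
bounded ancient MILD solutions, KNSS 2009 §4 (i)), with `ξ ∈ C^∞(−∞,0)`. Vorticity is Galilean
invariant (`curl (V(t, · − ξ t) + ξ′ t) = (curl V(t))(· − ξ t)`), so «unthreaded about the fixed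
centre `x₀`» for `u` is «unthreaded about the MOVING centre `x₀ − ξ(t)`» for `V`, and spatially
constant slices of `V` are spatially constant slices of `u`. Hence:

* ★ `poloidalLiouville_of_movingCentre` / `poloidalLiouville_of_movingCentre'` — the W1 decl
  `PoloidalLiouville` (routes `ThreadingFlux` / `UnthreadedDoor`, same body) FOLLOWS BY NAME from
  the Liouville statement for print's class with a moving centre: «every bounded, jointly `C^∞`,
  weakly divergence-free ancient KNSS-mild `V` on `(−∞,0) × ℝ³` whose vorticity is tangent to the
  spheres about a smooth curve `x₀ − ξ(t)` with bounded velocity `ξ′` has spatially constant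
  slices».

HONEST LABEL: a REDUCTION (implication between the wall statement and a statement over a smaller,
better-equipped class: pointwise Oseen identity, uniform bound, joint smoothness, KNSS derivative
bounds and a pressure are all available for `V`); the moving-centre statement is NOT proved here
and W1 stays OPEN. Information for the planners: the residual freedom of W1's duality-form class
over print's class is AT MOST one smooth curve with bounded velocity (the antecedent quantifies over
all such curves; only the inertial-gauge paths of members actually arise).

## References

* G. Koch, N. Nadirashvili, G. Seregin, V. Šverák, Acta Math. 203 (2009), §1 p. 3 (parasitic
  solutions and accelerated frames), §4 (i)–(ii). [KochNadirashviliSereginSverak2009]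

WHAT THIS IS NOT: not a proof of `PoloidalLiouville`, of (L), or of NS regularity.
-/

-- the summit and its single problem share the name (D-0017 nested layout)
set_option linter.dupNamespace false

noncomputable section

open MeasureTheory Filter Set Function Metric
open scoped Topology ENNReal ContDiff RealInnerProductSpace

namespace Summit.NavierStokesRegularity.NavierStokesRegularity.Theorems

open TypeIliouvilleL.InertialGauge Literature.Analysis Literature.Analysis.FluidPDE in
/-- ★ **W1 ⟸ MOVING-CENTRE LIOUVILLE IN PRINT'S CLASS (route `ThreadingFlux`).** Suppose that every
ancient field `V : (−∞,0) × ℝ³ → ℝ³` which is jointly `C^∞` on the slab, uniformly bounded, weakly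
divergence free on every slice, KNSS/Oseen-mild between all pairs of negative times, and
UNTHREADED ABOUT A SMOOTH MOVING CENTRE — `⟪y − (x₀ − ξ t), curl V(t) y⟫ = 0` for a point `x₀` and a
path `ξ ∈ C^∞(−∞,0)` with BOUNDED velocity `ξ′` — has spatially constant slices. Then the W1 crux `PoloidalLiouville` holds:
a smooth member `u` of the duality-form class unthreaded about `x₀` is `V(t, · − ξ t) + ξ′ t` by
`inertialGauge_of_smooth`, vorticity is Galilean invariant (`curl_comp_add_const`,
`curl_sub_const_eq`), and constants pull back to constants. -/
theorem poloidalLiouville_of_movingCentre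
    (h : ∀ (V : ℝ → EuclideanSpace ℝ (Fin 3) → EuclideanSpace ℝ (Fin 3))
      (ξ : ℝ → EuclideanSpace ℝ (Fin 3)) (x₀ : EuclideanSpace ℝ (Fin 3)) (K L : ℝ),
      ContDiffOn ℝ ∞ (Function.uncurry V) (Set.Iio 0 ×ˢ Set.univ) →
      (∀ t < 0, ∀ y, ‖V t y‖ ≤ K) →
      ContDiffOn ℝ ∞ ξ (Set.Iio 0) →
      (∀ t < 0, ‖deriv ξ t‖ ≤ L) →
      (∀ t < 0, Literature.Analysis.FluidPDE.IsWeaklyDivFree (V t)) →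
      (∀ s t : ℝ, s < t → t < 0 → ∀ y, V t y =
        Literature.Analysis.UnboundedOperators.heatExtension (V s) (t - s) y -
          Literature.Analysis.FluidPDE.oseenDuhamel 1 s V V t y) →
      (∀ t < 0, ∀ y, ⟪y - (x₀ - ξ t), Literature.Analysis.FluidPDE.curl (V t) y⟫ = 0) →
      ∀ t < 0, ∃ b : EuclideanSpace ℝ (Fin 3), ∀ y, V t y = b) :
    Summit.NavierStokesRegularity.NavierStokesRegularity.Theses.ThreadingFlux.PoloidalLiouville := by
  intro u hu _hmeas hsm hx₀ t ht
  obtain ⟨x₀, hx₀⟩ := hx₀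
  obtain ⟨ξ, hξ, K, hbd, hVc, hVdiv, hVmild⟩ := inertialGauge_of_smooth u hu hsm
  set V : ℝ → EuclideanSpace ℝ (Fin 3) → EuclideanSpace ℝ (Fin 3) :=
    fun t y => u t (y + ξ t) - deriv ξ t with hV
  -- `V` is jointly smooth (KNSS Prop. 4.1 on windows)
  have hVsm : ContDiffOn ℝ ∞ (uncurry V) (Iio 0 ×ˢ univ) :=
    contDiffOn_slab_of_oseenMild hVc hbd hVdiv hVmild
  -- vorticity is Galilean invariant: `curl V(t) y = curl u(t) (y + ξ t)`
  have hcurl : ∀ t < 0, ∀ y, curl (V t) y = curl (u t) (y + ξ t) := by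
    intro t _ y
    have h1 : curl (V t) = curl (fun y => u t (y + ξ t)) := by
      simp only [hV]
      exact curl_sub_const_eq (fun y => u t (y + ξ t)) (deriv ξ t)
    rw [h1, curl_comp_add_const]
  -- `V` is unthreaded about the moving centre `x₀ − ξ t`
  have hunthr : ∀ t < 0, ∀ y, ⟪y - (x₀ - ξ t), curl (V t) y⟫ = 0 := by
    intro t ht y
    rw [hcurl t ht y, show y - (x₀ - ξ t) = y + ξ t - x₀ by abel]
    exact hx₀ t ht (y + ξ t)
  -- the frame velocity is bounded: `ξ′ t = u t (ξ t) − V t 0`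
  obtain ⟨C, hC⟩ := hu.2
  have hvel : ∀ t < 0, ‖deriv ξ t‖ ≤ C + K := by
    intro t ht
    have h1 : deriv ξ t = u t (0 + ξ t) - V t 0 := by
      simp only [hV]
      abel
    rw [h1]
    exact (norm_sub_le _ _).trans (add_le_add (hC t ht _) (hbd t ht 0))
  obtain ⟨b, hb⟩ := h V ξ x₀ K (C + K) hVsm hbd hξ hvel hVdiv hVmild hunthr t ht
  refine ⟨b + deriv ξ t, fun x => ?_⟩
  have hx : u t x = V t (x - ξ t) + deriv ξ t := by
    simp only [hV, sub_add_cancel]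
  rw [hx, hb]

/-- ★ The same reduction for the token-identical W1 decl of route `UnthreadedDoor`. -/
theorem poloidalLiouville_of_movingCentre'
    (h : ∀ (V : ℝ → EuclideanSpace ℝ (Fin 3) → EuclideanSpace ℝ (Fin 3))
      (ξ : ℝ → EuclideanSpace ℝ (Fin 3)) (x₀ : EuclideanSpace ℝ (Fin 3)) (K L : ℝ),
      ContDiffOn ℝ ∞ (Function.uncurry V) (Set.Iio 0 ×ˢ Set.univ) →
      (∀ t < 0, ∀ y, ‖V t y‖ ≤ K) →
      ContDiffOn ℝ ∞ ξ (Set.Iio 0) →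
      (∀ t < 0, ‖deriv ξ t‖ ≤ L) →
      (∀ t < 0, Literature.Analysis.FluidPDE.IsWeaklyDivFree (V t)) →
      (∀ s t : ℝ, s < t → t < 0 → ∀ y, V t y =
        Literature.Analysis.UnboundedOperators.heatExtension (V s) (t - s) y -
          Literature.Analysis.FluidPDE.oseenDuhamel 1 s V V t y) →
      (∀ t < 0, ∀ y, ⟪y - (x₀ - ξ t), Literature.Analysis.FluidPDE.curl (V t) y⟫ = 0) →
      ∀ t < 0, ∃ b : EuclideanSpace ℝ (Fin 3), ∀ y, V t y = b) :
    Summit.NavierStokesRegularity.NavierStokesRegularity.Theses.UnthreadedDoor.PoloidalLiouville :=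
  poloidalLiouville_of_movingCentre h

end Summit.NavierStokesRegularity.NavierStokesRegularity.Theorems

end
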